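import Summits.FinalStateConjecture.FinalStateConjecture.Cruxes.HonestFixedRadiusSettling.Disproof
import Summits.FinalStateConjecture.FinalStateConjecture.Theorems.PhotonSphereChannelsTameCensorshipReduction

/-!
# Crux-ideate sketches for `StarvedNecks.HonestFixedRadiusSettling` (stmt-FinalStateConjecture-13550)
# — ideator 2 (gen 2), round 1

Two first lemmas, both kernel-checked (no `sorry`):

* §1–§2 **Sector selection by the cusp** (`hasCodimAtLeastIn_one_of_sector`,
  `isChristodoulouGeneric_one_of_sector`): Christodoulou codimension `≥ 1` at an exceptional datum
  `d` follows from a jointly smooth admissible 2-parameter family `G` through `d` which is GOOD ON A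
  ONE-SIDED SECTOR `{0 < s₀, |s₁| ≤ s₀}` (injective and admissible on the closed sector only): the
  cusp `c ↦ (c², c³)` enters the sector from both signs of `c`, is injective, and `G ∘ cusp` is a
  typed witness after squashing (`hasCodimAtLeastIn_one_of_local`, tree). Strictly weaker hypothesis
  than `TameStrataCurveSelection.ConeSelection` (finitely many exceptional arcs ⇒ a good two-sided
  LINE); here the exceptional trace may fill the whole complementary sector.
* §3 **Transfer for card `stability-writes-the-charts`** (`honestFixedRadiusSettling_of_basin`):
  for ANY pointwise "basin" predicate `B` on admissible data, sector witnesses for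
  `(∃ MGHD) ∧ B` plus the read-off implication `B D → ∀ MGHD, SettlesAt 𝒟` (the disprover's named
  `∀`-MGHD clause of the crux, `Disproof.SettlesAt`) give the crux BY NAME
  (`rw [crux_iff_codim_one]`, honouring Disproof §0). `B` is a variable here: the card's `B` =
  hyperboloidal weighted Kerr-basin entry (definition request D1), its read-off = the output gauge of
  the Kerr stability theorems.
* §4 the same transfer with a plain 1-parameter local witness (for lines whose cure is two-sided).
-/

noncomputable section

set_option linter.dupNamespace false

open Manifold Bundle Set Function
open scoped ContDiff Topology

namespace Summit.FinalStateConjecture.FinalStateConjecture.Cruxes.HonestFixedRadiusSettling.Ideator2g2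

open Literature.Geometry.Lorentzian
open Summit.FinalStateConjecture.FinalStateConjecture.Theorems.PhotonSphereChannels
  (isSmoothDataFamily_comp contDiff_euclideanOne_apply hasCodimAtLeastIn_one_of_local)
open Summit.FinalStateConjecture.FinalStateConjecture.Cruxes.HonestFixedRadiusSettling.Disproof
  (SettlesHonestly SettlesAt Codim crux_iff_codim_one)
open Summit.FinalStateConjecture.FinalStateConjecture.Theses.StarvedNecks (HonestFixedRadiusSettling)

/-! ## §1 The cusp `c ↦ (c², c³)` in `ℝ²` -/

/-- The cusp map `ℝ¹ → ℝ²`, `c ↦ (c₀², c₀³)`. -/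
def cusp (c : EuclideanSpace ℝ (Fin 1)) : EuclideanSpace ℝ (Fin 2) :=
  (c 0) ^ 2 • EuclideanSpace.single (0 : Fin 2) (1 : ℝ) +
    (c 0) ^ 3 • EuclideanSpace.single (1 : Fin 2) (1 : ℝ)

theorem cusp_apply_zero (c : EuclideanSpace ℝ (Fin 1)) : cusp c 0 = (c 0) ^ 2 := by
  simp [cusp]

theorem cusp_apply_one (c : EuclideanSpace ℝ (Fin 1)) : cusp c 1 = (c 0) ^ 3 := by
  simp [cusp]

theorem contDiff_cusp : ContDiff ℝ ∞ cusp :=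
  ((contDiff_euclideanOne_apply.pow 2).smul contDiff_const).add
    ((contDiff_euclideanOne_apply.pow 3).smul contDiff_const)

theorem cusp_zero : cusp 0 = 0 := by
  ext i
  fin_cases i <;> simp [cusp]

/-- A point of `ℝ¹` vanishes iff its coordinate does. -/
theorem euclideanOne_eq_zero_iff (c : EuclideanSpace ℝ (Fin 1)) : c = 0 ↔ c 0 = 0 := by
  constructor
  · rintro rfl; rfl
  · intro h
    ext i
    fin_cases i
    exact h

/-- The cusp is injective (the cube is). -/
theorem cusp_injective : Function.Injective cusp := by
  intro c c' h
  have h1 : (c 0) ^ 3 = (c' 0) ^ 3 := by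
    rw [← cusp_apply_one, ← cusp_apply_one, h]
  have h2 : c 0 = c' 0 := (Odd.strictMono_pow (by decide : Odd 3)).injective h1
  ext i
  fin_cases i
  exact h2

/-- For `|c₀| ≤ 1` the cusp lies in the closed one-sided sector `{0 ≤ s₀, |s₁| ≤ s₀}`. -/
theorem cusp_mem_sector {c : EuclideanSpace ℝ (Fin 1)} (hc : |c 0| ≤ 1) :
    0 ≤ cusp c 0 ∧ |cusp c 1| ≤ cusp c 0 := by
  rw [cusp_apply_zero, cusp_apply_one]
  refine ⟨sq_nonneg _, ?_⟩
  have h0 : 0 ≤ |c 0| := abs_nonneg _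
  have : |c 0| ^ 3 ≤ |c 0| ^ 2 := by nlinarith [sq_nonneg (|c 0|)]
  calc |c 0 ^ 3| = |c 0| ^ 3 := abs_pow _ _
    _ ≤ |c 0| ^ 2 := this
    _ = c 0 ^ 2 := sq_abs _

/-- Off `c = 0` the cusp lies in the OPEN one-sided sector `{0 < s₀}`. -/
theorem cusp_apply_zero_pos {c : EuclideanSpace ℝ (Fin 1)} (hc : c ≠ 0) : 0 < cusp c 0 := by
  rw [cusp_apply_zero]
  have : c 0 ≠ 0 := fun h ↦ hc ((euclideanOne_eq_zero_iff c).2 h)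
  positivity

/-! ## §2 Sector selection -/

section Sector

variable {E : Type*} [NormedAddCommGroup E] [NormedSpace ℝ E] {H : Type*} [TopologicalSpace H]
  {I : ModelWithCorners ℝ E H} {X : Type*} [TopologicalSpace X] [ChartedSpace H X]
  [IsManifold I ∞ X]

/-- **Sector selection (one-sided cures suffice).** If through every exceptional datum `d ∈ 𝓔`
passes a jointly smooth 2-parameter family `G` with `G 0 = d` which, on the CLOSED one-sided sector
`S = {0 ≤ s₀, |s₁| ≤ s₀}`, is injective and admissible, and which avoids `𝓔` on the sector off
`0` (`0 < s₀`), then `𝓔` has Christodoulou codimension `≥ 1` in `𝓓`: the witness curve is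
`G ∘ cusp`, entering the sector from both signs of `c`. No hypothesis is made on `G` outside `S`
(e.g. cleaning families, even in the scale parameter, are not injective on `ℝ²`). -/
theorem hasCodimAtLeastIn_one_of_sector {𝓓 𝓔 : Set (InitialDataSet I X)}
    (h : ∀ d ∈ 𝓔, ∃ G : EuclideanSpace ℝ (Fin 2) → InitialDataSet I X,
      InitialDataSet.IsSmoothDataFamily 2 G ∧ G 0 = d ∧
      Set.InjOn G {q | 0 ≤ q 0 ∧ |q 1| ≤ q 0} ∧
      (∀ q : EuclideanSpace ℝ (Fin 2), 0 ≤ q 0 → |q 1| ≤ q 0 → G q ∈ 𝓓) ∧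
      ∀ q : EuclideanSpace ℝ (Fin 2), 0 < q 0 → |q 1| ≤ q 0 → G q ∉ 𝓔) :
    InitialDataSet.HasCodimAtLeastIn 𝓓 𝓔 1 := by
  refine hasCodimAtLeastIn_one_of_local fun d hd ↦ ?_
  obtain ⟨G, hG, hG0, hinj, hadm, hgood⟩ := h d hd
  refine ⟨1, G ∘ cusp, one_pos, isSmoothDataFamily_comp hG contDiff_cusp, ?_, ?_, ?_, ?_⟩
  · show G (cusp 0) = d
    rw [cusp_zero, hG0]
  · intro c c' hc hc' hcc'
    have hS : cusp c ∈ {q : EuclideanSpace ℝ (Fin 2) | 0 ≤ q 0 ∧ |q 1| ≤ q 0} :=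
      cusp_mem_sector hc.le
    have hS' : cusp c' ∈ {q : EuclideanSpace ℝ (Fin 2) | 0 ≤ q 0 ∧ |q 1| ≤ q 0} :=
      cusp_mem_sector hc'.le
    exact cusp_injective (hinj hS hS' hcc')
  · intro c hc
    exact hadm _ (cusp_mem_sector hc.le).1 (cusp_mem_sector hc.le).2
  · intro c hc0 hc
    exact hgood _ (cusp_apply_zero_pos hc0) (cusp_mem_sector hc.le).2

/-- Sector selection, property form. -/
theorem isChristodoulouGeneric_one_of_sector {𝓓 : Set (InitialDataSet I X)}
    {P : InitialDataSet I X → Prop}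
    (h : ∀ d ∈ 𝓓, ¬ P d → ∃ G : EuclideanSpace ℝ (Fin 2) → InitialDataSet I X,
      InitialDataSet.IsSmoothDataFamily 2 G ∧ G 0 = d ∧
      Set.InjOn G {q | 0 ≤ q 0 ∧ |q 1| ≤ q 0} ∧
      (∀ q : EuclideanSpace ℝ (Fin 2), 0 ≤ q 0 → |q 1| ≤ q 0 → G q ∈ 𝓓) ∧
      ∀ q : EuclideanSpace ℝ (Fin 2), 0 < q 0 → |q 1| ≤ q 0 → P (G q)) :
    InitialDataSet.IsChristodoulouGeneric 𝓓 P 1 := by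
  refine hasCodimAtLeastIn_one_of_sector fun d hd ↦ ?_
  obtain ⟨G, hG, hG0, hinj, hadm, hgood⟩ := h d hd.1 hd.2
  exact ⟨G, hG, hG0, hinj, hadm, fun q hq hq' hmem ↦ hmem.2 (hgood q hq hq')⟩

end Sector

/-! ## §3 Transfer for card `stability-writes-the-charts`

`B` is an arbitrary pointwise predicate on data ("some late asymptotically hyperboloidal slice of
an MGHD of `D` lies in the Kerr-stability basin", to be typed as definition request D1). The two
stubs of the line are exactly the two hypotheses; the conclusion is the crux by name. -/

section Basin

variable (B : ∀ (X : Type) [TopologicalSpace X] [ChartedSpace E3 X] [IsManifold (𝓡 3) ∞ X]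
    [ConnectedSpace X], InitialDataSet (𝓡 3) X → Prop)

/-- STUB SHAPE 1 (generic, the large-data content): Christodoulou-generically — in the one-sided
SECTOR form, along cleaning × interior-cure 2-families — an MGHD exists and the datum enters the
basin `B`. -/
def SectorBasinEntry : Prop :=
  ∀ (X : Type) [TopologicalSpace X] [ChartedSpace E3 X] [IsManifold (𝓡 3) ∞ X] [T2Space X]
    [SecondCountableTopology X] [ConnectedSpace X],
    ∀ d ∈ admissibleVacuumData X, ¬ ((∃ 𝒟 : VacuumCauchyDevelopment d, 𝒟.IsMaximal) ∧ B X d) →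
      ∃ G : EuclideanSpace ℝ (Fin 2) → InitialDataSet (𝓡 3) X,
        InitialDataSet.IsSmoothDataFamily 2 G ∧ G 0 = d ∧
        Set.InjOn G {q | 0 ≤ q 0 ∧ |q 1| ≤ q 0} ∧
        (∀ q : EuclideanSpace ℝ (Fin 2), 0 ≤ q 0 → |q 1| ≤ q 0 → G q ∈ admissibleVacuumData X) ∧
        ∀ q : EuclideanSpace ℝ (Fin 2), 0 < q 0 → |q 1| ≤ q 0 →
          (∃ 𝒟 : VacuumCauchyDevelopment (G q), 𝒟.IsMaximal) ∧ B X (G q)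

/-- STUB SHAPE 2 (pointwise, the endgame READ-OFF): a datum in the basin settles honestly at every
MGHD — complete `𝓘⁺` (sojourn form) and an honest `C⁴` fixed-radius decomposition of the
self-determined exterior (`Disproof.SettlesAt`, verbatim the crux's `∀`-MGHD clause). -/
def BasinReadOff : Prop :=
  ∀ (X : Type) [TopologicalSpace X] [ChartedSpace E3 X] [IsManifold (𝓡 3) ∞ X] [T2Space X]
    [SecondCountableTopology X] [ConnectedSpace X],
    ∀ d ∈ admissibleVacuumData X, B X d → ∀ 𝒟 : VacuumCauchyDevelopment d, 𝒟.IsMaximal → SettlesAt 𝒟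

/-- **Transfer.** Sector basin entry + read-off ⇒ the crux, BY NAME. -/
theorem honestFixedRadiusSettling_of_basin (hE : SectorBasinEntry B) (hR : BasinReadOff B) :
    HonestFixedRadiusSettling := by
  rw [crux_iff_codim_one]
  intro X _ _ _ _ _ _
  refine isChristodoulouGeneric_one_of_sector fun d hd hnot ↦ ?_
  have hnot' : ¬ ((∃ 𝒟 : VacuumCauchyDevelopment d, 𝒟.IsMaximal) ∧ B X d) := by
    rintro ⟨hex, hB⟩
    exact hnot ⟨hex, fun 𝒟 h𝒟 ↦ hR X d hd hB 𝒟 h𝒟⟩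
  obtain ⟨G, hG, hG0, hinj, hadm, hgood⟩ := hE X d hd hnot'
  refine ⟨G, hG, hG0, hinj, hadm, fun q hq hq' ↦ ?_⟩
  obtain ⟨hex, hB⟩ := hgood q hq hq'
  exact ⟨hex, fun 𝒟 h𝒟 ↦ hR X (G q) (hadm q hq.le hq') hB 𝒟 h𝒟⟩

end Basin

/-! ## §4 One-parameter local version (two-sided cures) -/

/-- If the cure is two-sided, a local 1-parameter witness for `SettlesHonestly` suffices
(`hasCodimAtLeastIn_one_of_local`, tree). Recorded for crux-plan skeletons. -/
theorem honestFixedRadiusSettling_of_local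
    (h : ∀ (X : Type) [TopologicalSpace X] [ChartedSpace E3 X] [IsManifold (𝓡 3) ∞ X] [T2Space X]
      [SecondCountableTopology X] [ConnectedSpace X],
      ∀ d ∈ admissibleVacuumData X, ¬ SettlesHonestly d →
        ∃ (ε : ℝ) (F : EuclideanSpace ℝ (Fin 1) → InitialDataSet (𝓡 3) X), 0 < ε ∧
          InitialDataSet.IsSmoothDataFamily 1 F ∧ F 0 = d ∧
          (∀ c c' : EuclideanSpace ℝ (Fin 1), |c 0| < ε → |c' 0| < ε → F c = F c' → c = c') ∧
          (∀ c : EuclideanSpace ℝ (Fin 1), |c 0| < ε → F c ∈ admissibleVacuumData X) ∧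
          ∀ c : EuclideanSpace ℝ (Fin 1), c ≠ 0 → |c 0| < ε → SettlesHonestly (F c)) :
    HonestFixedRadiusSettling := by
  rw [crux_iff_codim_one]
  intro X _ _ _ _ _ _
  refine hasCodimAtLeastIn_one_of_local fun d hd ↦ ?_
  obtain ⟨ε, F, hε, hF, h0, hinj, hadm, hP⟩ := h X d hd.1 hd.2
  exact ⟨ε, F, hε, hF, h0, hinj, hadm, fun c hc hcε hmem ↦ hmem.2 (hP c hc hcε)⟩

end Summit.FinalStateConjecture.FinalStateConjecture.Cruxes.HonestFixedRadiusSettling.Ideator2g2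

end
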